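import Literature.NumberTheory.EllipticCurves.ZpExtensionEisensteinPiLevelH2TotalBoundProofs
import HarnessLib

/-!
# `#H²(K_w, T/π^jT) ≤ p^{2p^s}` for EVERY level `j`, from an adapted basis of the `E[p^k]`
# (theorems only — no definition, no named fact, no instance, no `sorry`)

Topic `NumberTheory/EllipticCurves` (sequel of `ZpExtensionEisensteinPiLevelH2TotalBoundProofs`: `natCard_two_piLevel_le` for
`i ≥ 1` under adapted-basis / scalar binders).  Brick (F4-glue) of the uniform-`ι` road of cell `pub/bsd-print-x9` (stub
`stub_h5bAtS`): the BINDER DISCHARGE.  The level count `natCard_two_piLevel_le` takes an adapted pair `P₀, Q₀` of `E[p^k]`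
(`P₀` generating the cyclic plus part `Fil_w E[p^k]`), the integer scalars `λ₁, λ₂` by which `g₀` acts on `P₀` and on `Q₀`
modulo `Fil_w`, and the integer `c` prime to `p` by which `g₀` acts on `μ_{p^k}`.  All of these EXIST for free:

* `exists_adapted_pair_of_addEquiv` — from an adapted coordinate `e : M ≃ (ℤ/n)²` with `Fil = {e(·)₁ = 0}` (the cell's binder
  `hbasis`), the pair `P₀ = e⁻¹(1,0) ∈ Fil`, `Q₀ = e⁻¹(0,1)` with `Fil = ℤ·P₀` and `M = ℤ·P₀ + ℤ·Q₀`;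
* `exists_int_forall_mu_apply_eq_smul` — every `g ∈ Γ_F` acts on the cyclic group `μ_{p^k}(F̄)` by an integer `c` with `p ∤ c`
  (`char F = 0`);
* `WeierstrassCurve.natCard_two_piLevel_zero_le` — the level `j = 0` is the zero module, `#H² ≤ 1`;
* `WeierstrassCurve.natCard_two_piLevel_le_of_basis` — **for every `j`, `H²(K_w, Level j)` is finite of order `≤ p^{2p^s}`**
  given only `hbasis`, `κ(g₀) = p^s` and `p^s < m` (`λ₁`, `λ₂` from the `Γ_{K_w}`-stability of `Fil_w`).

This is literally the pair `(hfin, hcard)` consumed by the cell's `piTorsionCut_hH2_of_natCard_le` (`c' = 2p^s`).  No summit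
statement is proved; BSD is not proved by any of this.

References: [Howard2004HeegnerKolyvagin] H.0, §3.1 (arXiv:1202.6340 p. 15 L56–62), Lemma 3.2.7; [MilneADT2006] I Cor. 2.3;
[GreenbergLNM1716] §2 (ordinary filtration of `E[p^∞]`, rank-one direct summand).
-/

set_option autoImplicit false

noncomputable section

open Function NumberField IsDedekindDomain Field
open scoped NumberField ContRepresentation

universe u

namespace Literature.NumberTheory.GaloisRepresentations

/-! ## §1 Adapted pairs and integer scalars -/

/-- **Adapted pair from an adapted coordinate.**  If `e : M ≃ (ℤ/n)²` with `Fil = {x | e x 1 = 0}`, then `P₀ := e⁻¹(δ₀) ∈ Fil`,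
`Q₀ := e⁻¹(δ₁)` satisfy `Fil = ℤ·P₀` and `M = ℤ·P₀ + ℤ·Q₀`. [cite: GreenbergLNM1716, §2 (rank-one direct summand Fil of E[p^k])]
[cite: Howard2004HeegnerKolyvagin, H.0 and §3.1 (arXiv:1202.6340 p. 15 L56–62)] -/
theorem exists_adapted_pair_of_addEquiv {M : Type*} [AddCommGroup M] {n : ℕ} [NeZero n] (Fil : Submodule ℤ M)
    (e : M ≃+ (Fin 2 → ZMod n)) (he : ∀ x, x ∈ Fil ↔ e x 1 = 0) :
    ∃ P₀ Q₀ : M, P₀ ∈ Fil ∧ (∀ a ∈ Fil, ∃ k : ℤ, k • P₀ = a) ∧ ∀ a : M, ∃ n₁ n₂ : ℤ, n₁ • P₀ + n₂ • Q₀ = a := by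
  classical
  have key : ∀ v : Fin 2 → ZMod n, (v 0).val • (Pi.single 0 1 : Fin 2 → ZMod n) + (v 1).val • Pi.single 1 1 = v := by
    intro v
    ext i
    fin_cases i <;> simp [-ZMod.natCast_val, ZMod.natCast_zmod_val]
  have hdec : ∀ a : M, ((e a 0).val : ℤ) • e.symm (Pi.single 0 1) + ((e a 1).val : ℤ) • e.symm (Pi.single 1 1) = a := by
    intro a
    rw [natCast_zsmul, natCast_zsmul, ← map_nsmul, ← map_nsmul, ← map_add, key, AddEquiv.symm_apply_apply]
  refine ⟨e.symm (Pi.single 0 1), e.symm (Pi.single 1 1), ?_, ?_, fun a ↦ ⟨_, _, hdec a⟩⟩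
  · rw [he, AddEquiv.apply_symm_apply, Pi.single_eq_of_ne (by decide)]
  · intro a ha
    refine ⟨((e a 0).val : ℤ), ?_⟩
    have h1 : (e a 1).val = 0 := by rw [(he a).mp ha, ZMod.val_zero]
    conv_rhs => rw [← hdec a, h1]
    rw [Nat.cast_zero, zero_smul, add_zero]

section Mu

open DiscreteGaloisModule

variable (F : Type u) [Field F] [CharZero F]

/-- **Every Galois element acts on `μ_{p^k}(F̄)` by an integer prime to `p`.**  `μ_{p^k}(F̄) ≃ ℤ/p^k` is cyclic (`char F = 0`),
so the additive automorphism `ζ ↦ g ζ` is multiplication by an integer `c`; `c` is prime to `p` because `g` is injective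
(`p ∣ c` would kill `p^{k-1} ∈ ℤ/p^k`). [cite: MilneADT2006, Ch. I §2 (μ_n(K̄) ≃ ℤ/n as a group)]
[cite: Howard2004HeegnerKolyvagin, Lemma 3.2.7 (arXiv:1202.6340 p. 16 L150–156)] -/
theorem exists_int_forall_mu_apply_eq_smul {p : ℕ} [hp : Fact p.Prime] (k : ℕ) (g : absoluteGaloisGroup F) :
    ∃ c : ℤ, (∀ ζ : MuCarrier F (p ^ k), mu F (p ^ k) g ζ = c • ζ) ∧ ¬ (p : ℤ) ∣ c := by
  classical
  haveI : NeZero (p ^ k) := ⟨pow_ne_zero k hp.out.ne_zero⟩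
  -- injectivity of `g` on `μ_{p^k}`
  have hinj : Function.Injective (mu F (p ^ k) g) := by
    intro a b hab
    have h := congrArg (mu F (p ^ k) g⁻¹) hab
    rwa [← Module.End.mul_apply, ← map_mul, inv_mul_cancel, map_one, Module.End.one_apply, ← Module.End.mul_apply,
      ← map_mul, inv_mul_cancel, map_one, Module.End.one_apply] at h
  rcases Nat.eq_zero_or_pos k with rfl | hk
  · -- `μ_1` is trivial
    have hcard : Nat.card (MuCarrier F (p ^ 0)) = 1 := by
      rw [Nat.card_congr (muEquivZMod F (p ^ 0)).toEquiv, Nat.card_eq_fintype_card, ZMod.card, pow_zero]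
    haveI : Subsingleton (MuCarrier F (p ^ 0)) := (Nat.card_eq_one_iff_unique.mp hcard).1
    refine ⟨1, fun ζ ↦ Subsingleton.elim _ _, ?_⟩
    exact_mod_cast hp.out.not_dvd_one
  · let e := muEquivZMod F (p ^ k)
    let f : ZMod (p ^ k) →+ ZMod (p ^ k) :=
      (e.toAddMonoidHom.comp (mu F (p ^ k) g).toAddMonoidHom).comp e.symm.toAddMonoidHom
    have hf_apply : ∀ x, f x = e (mu F (p ^ k) g (e.symm x)) := fun _ ↦ rfl
    have hf : ∀ x, f x = x * f 1 := by
      intro x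
      have hx : x = (x.val : ℕ) • (1 : ZMod (p ^ k)) := by rw [nsmul_eq_mul, mul_one, ZMod.natCast_zmod_val]
      conv_lhs => rw [hx, map_nsmul]
      rw [nsmul_eq_mul, ZMod.natCast_zmod_val]
    have hfinj : Function.Injective f := e.injective.comp (hinj.comp e.symm.injective)
    refine ⟨((f 1).val : ℤ), fun ζ ↦ ?_, fun hdvd ↦ ?_⟩
    · apply e.injective
      have h := hf (e ζ)
      rw [hf_apply, AddEquiv.symm_apply_apply] at h
      rw [natCast_zsmul, map_nsmul, h, nsmul_eq_mul, ZMod.natCast_zmod_val, mul_comm]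
    · obtain ⟨c', hc'⟩ := hdvd
      have hc'' : ((f 1).val : ZMod (p ^ k)) = (p : ZMod (p ^ k)) * (c' : ZMod (p ^ k)) := by
        have h := congrArg (fun z : ℤ ↦ (z : ZMod (p ^ k))) hc'
        push_cast at h
        exact h
      have h0 : f ((p ^ (k - 1) : ℕ) : ZMod (p ^ k)) = 0 := by
        rw [hf, ← ZMod.natCast_zmod_val (f 1), hc'', ← mul_assoc, ← Nat.cast_mul, ← pow_succ, Nat.sub_add_cancel hk,
          ZMod.natCast_self, zero_mul]
      have h1 : ((p ^ (k - 1) : ℕ) : ZMod (p ^ k)) = 0 := hfinj (by rw [h0, map_zero])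
      rw [ZMod.natCast_eq_zero_iff, Nat.pow_dvd_pow_iff_le_right hp.out.one_lt] at h1
      omega

end Mu

end Literature.NumberTheory.GaloisRepresentations

namespace Literature.NumberTheory.EllipticCurves

namespace ZpExtension

open IwasawaAlgebra IwasawaAlgebra.EisensteinCoeff Literature.NumberTheory.GaloisRepresentations
open Literature.NumberTheory.GaloisRepresentations.DiscreteGaloisModule
open Literature.NumberTheory.GaloisCohomology.Howard2004 Literature.NumberTheory.Automorphic

variable {K : Type} [Field K] [NumberField K] (E : WeierstrassCurve K) [E.IsElliptic] {p : ℕ} [hp : Fact p.Prime]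
  (κ' : ZpExtension K p) {m : ℕ} (hm : 1 ≤ m)

/-! ## §2 The level `j = 0` and the packaged count -/

/-- **The level `0` of the curve's `π`-adic refinement datum is the zero module** (`T/π^0T = 0`).
[cite: Howard2004HeegnerKolyvagin, §2.2 (arXiv:1202.6340 p. 11: the levels S_𝔮/π^i)] -/
theorem _root_.WeierstrassCurve.piLevel_zero_eq_zero (x : (E.eisensteinPiRefinementDatum κ' hm).Level 0) : x = 0 := by
  have h := (E.eisensteinPiRefinementDatum κ' hm).pow_smul_level_eq_zero 0 x
  rwa [pow_zero, one_smul] at h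

/-- **`#H²(K_w, T/π^0T) ≤ 1`**: the level `0` is zero, so its `H²` is trivial.
[cite: Howard2004HeegnerKolyvagin, §2.2 and Lemma 3.2.7 (arXiv:1202.6340 p. 16 L150–156)] -/
theorem _root_.WeierstrassCurve.natCard_two_piLevel_zero_le (w : HeightOneSpectrum (𝓞 K)) :
    Finite (galoisCohomology (GaloisRep.toLocal w ((E.eisensteinPiRefinementDatum κ' hm).levelRep 0)) 2) ∧
      Nat.card (galoisCohomology (GaloisRep.toLocal w ((E.eisensteinPiRefinementDatum κ' hm).levelRep 0)) 2) ≤ 1 := by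
  haveI : Subsingleton ((E.eisensteinPiRefinementDatum κ' hm).Level 0) :=
    ⟨fun a b ↦ by rw [E.piLevel_zero_eq_zero κ' hm a, E.piLevel_zero_eq_zero κ' hm b]⟩
  haveI hsub : Subsingleton (galoisCohomology (GaloisRep.toLocal w ((E.eisensteinPiRefinementDatum κ' hm).levelRep 0)) 2) :=
    subsingleton_continuousCohomology_of_subsingleton
      (GaloisRep.toLocal w ((E.eisensteinPiRefinementDatum κ' hm).levelRep 0)).toTopRep 1
  exact ⟨Finite.of_subsingleton, Finite.card_le_one_iff_subsingleton.mpr hsub⟩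

set_option maxHeartbeats 800000 in
/-- **`#H²(K_w, T/π^jT) ≤ p^{2p^s}` for EVERY level `j`, from an adapted basis.**  `Φ` an ordinary datum at `w` whose plus
parts `Fil_w E[p^k]` (`k ≥ 1`) are coordinate lines of adapted coordinates `e_k : E[p^k] ≃ (ℤ/p^k)²` (`hbasis`), `g₀ ∈ Γ_{K_w}`
with `κ(g₀) = p^s`, `p^s < m`.  Then for every `j`, `H²(K_w, Level j)` is finite of order `≤ p^{2p^s}`: for `j = 0` the level is
zero; for `j ≥ 1` the adapted pair, the scalars `λ₁, λ₂` (stability of `Fil_w`) and the integer `c` of `g₀` on `μ_{p^k}` exist,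
and `natCard_two_piLevel_le` applies.  This is the pair `(hfin, hcard)` of the torsion-cut readout (`c' = 2p^s`).
[cite: Howard2004HeegnerKolyvagin, Lemma 3.2.7 (arXiv:1202.6340 p. 16 L150–156) and §3.1] [cite: MilneADT2006, Ch. I Cor. 2.3]
[cite: GreenbergLNM1716, §2 and proof of Prop. 4.15] -/
theorem _root_.WeierstrassCurve.natCard_two_piLevel_le_of_basis
    {w : HeightOneSpectrum (𝓞 K)}
    (Φ : OrdinaryFiltration (fun j ↦ E.torsionGaloisModule ((p : ℤ) ^ j)) (fun j ↦ E.torsionGaloisModuleReduce p j) w)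
    (hbasis : ∀ k, 1 ≤ k → ∃ e : E.geomTorsion ((p : ℤ) ^ k) ≃+ (Fin 2 → ZMod (p ^ k)), ∀ x, x ∈ Φ.fil k ↔ e x 1 = 0)
    {g₀ : absoluteGaloisGroup (w.adicCompletion K)} {s : ℕ}
    (hg₀ : (κ' (absGaloisRestrict K (w.adicCompletion K) g₀)).toAdd = ((p ^ s : ℕ) : ℤ_[p])) (hms : p ^ s < m) (j : ℕ) :
    Finite (galoisCohomology (GaloisRep.toLocal w ((E.eisensteinPiRefinementDatum κ' hm).levelRep j)) 2) ∧
      Nat.card (galoisCohomology (GaloisRep.toLocal w ((E.eisensteinPiRefinementDatum κ' hm).levelRep j)) 2) ≤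
        p ^ (2 * p ^ s) := by
  classical
  rcases Nat.eq_zero_or_pos j with rfl | hj
  · obtain ⟨hfin, hle⟩ := E.natCard_two_piLevel_zero_le κ' hm w
    exact ⟨hfin, hle.trans (Nat.one_le_pow _ _ hp.out.pos)⟩
  · haveI : CharZero (w.adicCompletion K) := charZero_of_injective_algebraMap (algebraMap K _).injective
    have hhost : 1 ≤ (E.eisensteinPiRefinementDatum κ' hm).host j := by
      rw [WeierstrassCurve.eisensteinPiRefinementDatum_host]
      exact Nat.div_pos (by omega) hm
    haveI : NeZero (p ^ (E.eisensteinPiRefinementDatum κ' hm).host j) := ⟨pow_ne_zero _ hp.out.ne_zero⟩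
    obtain ⟨e, he⟩ := hbasis _ hhost
    obtain ⟨P₀, Q₀, hP₀, hgen, hPQ⟩ :=
      exists_adapted_pair_of_addEquiv (Φ.fil ((E.eisensteinPiRefinementDatum κ' hm).host j)) e he
    obtain ⟨lam₁, hlam₁⟩ := hgen _ (Φ.smul_mem _ g₀ P₀ hP₀)
    obtain ⟨n₁, n₂, hQ⟩ := hPQ (E.torsionGaloisModule ((p : ℤ) ^ (E.eisensteinPiRefinementDatum κ' hm).host j)
      (absGaloisRestrict K (w.adicCompletion K) g₀) Q₀)
    have hlam₂ : E.torsionGaloisModule ((p : ℤ) ^ (E.eisensteinPiRefinementDatum κ' hm).host j)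
        (absGaloisRestrict K (w.adicCompletion K) g₀) Q₀ - n₂ • Q₀ ∈ Φ.fil ((E.eisensteinPiRefinementDatum κ' hm).host j) := by
      rw [← hQ, add_sub_cancel_right]
      exact (Φ.fil _).smul_mem n₁ hP₀
    obtain ⟨c, hc, hcp⟩ := exists_int_forall_mu_apply_eq_smul (p := p) (w.adicCompletion K)
      ((E.eisensteinPiRefinementDatum κ' hm).host j) g₀
    exact E.natCard_two_piLevel_le κ' hm Φ hj P₀ Q₀ hP₀ hgen hPQ hg₀ hms lam₁ hlam₁.symm n₂ hlam₂ c hc hcp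

end ZpExtension

end Literature.NumberTheory.EllipticCurves
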